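import Mathlib.NumberTheory.ArithmeticFunction.Misc
import Mathlib.NumberTheory.Divisors
import Mathlib.Analysis.SpecialFunctions.Log.Basic
import Mathlib.Data.Nat.Cast.Field
import HarnessLib

/-!
# The Liouville parity of a divisor comb (kernel of the «Liouville parity rule», STAIRCASE-Z.md §4)

When the window `[-b, b]` first accommodates the cluster of the `T`-smooth integer `n` (at
`b = ½ log n`), the lag pattern that enters lives on the DIVISORS of `n`, placed symmetrically at
`x_d = log d - ½ log n`, and the bottom pattern of the deleted lag form carries the Liouville signs
`(-1)^{Ω(d)}` (alternating along every single-prime step).  This file proves the elementary facts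
behind the observed SECTOR RULE «after the threshold `½ log n` the free sector of parity `Ω(n)`
relaxes first» (22/22 thresholds in the lineage-Z scan, `HOME/cc-s2-1/gen16/STAIRCASE-Z.md`):

* `cardFactors_div_add` : for `d ∣ n`, `n ≠ 0`: `Ω(n/d) + Ω(d) = Ω(n)`;
* `neg_one_pow_cardFactors_div` : `(-1)^{Ω(n/d)} = (-1)^{Ω(n)} · (-1)^{Ω(d)}` — the Liouville sign
  is reflected through `d ↦ n/d` with the factor `λ(n) = (-1)^{Ω(n)}`;
* `log_div_sub_half_log` : the positions are reflection-symmetric, `x_{n/d} = -x_d`;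
* ★ `liouvilleComb_neg` : for an even profile `φ` and reflection-symmetric amplitudes
  `a(n/d) = a(d)`, the Liouville-signed divisor comb
  `g(x) = Σ_{d ∣ n} (-1)^{Ω(d)} a(d) φ(x - x_d)` satisfies `g(-x) = (-1)^{Ω(n)} g(x)`:
  it is EVEN when `λ(n) = +1` and ODD when `λ(n) = -1` (`liouvilleComb_even`, `liouvilleComb_odd`).

Pure arithmetic/algebra (Mathlib only); nothing here bears on RH.
-/

open Finset ArithmeticFunction
open scoped ArithmeticFunction.Omega

set_option linter.dupNamespace false

namespace Summit.RiemannHypothesis.RiemannHypothesis.Theorems.SemilocalDeletionLiouvilleParity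

/-- `Ω` is additive over a divisor and its cofactor: `Ω(n/d) + Ω(d) = Ω(n)` for `d ∣ n`, `n ≠ 0`. -/
theorem cardFactors_div_add {n d : ℕ} (hn : n ≠ 0) (hd : d ∣ n) : Ω (n / d) + Ω d = Ω n := by
  have hd0 : d ≠ 0 := by
    rintro rfl
    exact hn (zero_dvd_iff.1 hd)
  have hq0 : n / d ≠ 0 := by
    intro h
    exact hn (by simpa [h] using (Nat.div_mul_cancel hd).symm)
  rw [← cardFactors_mul hq0 hd0, Nat.div_mul_cancel hd]

/-- The Liouville sign reflects through `d ↦ n/d` with the factor `λ(n) = (-1)^{Ω(n)}`: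
`(-1)^{Ω(n/d)} = (-1)^{Ω(n)} · (-1)^{Ω(d)}` (in any commutative ring). -/
theorem neg_one_pow_cardFactors_div {R : Type*} [CommRing R] {n d : ℕ} (hn : n ≠ 0) (hd : d ∣ n) :
    ((-1 : R)) ^ Ω (n / d) = (-1) ^ Ω n * (-1) ^ Ω d := by
  have h := cardFactors_div_add hn hd
  rw [← h, pow_add, mul_assoc, ← mul_pow]
  simp

/-- The positions `x_d = log d - ½ log n` of the divisor cluster are reflection-symmetric:
`x_{n/d} = -x_d` for `d ∣ n`, `n ≠ 0`. -/
theorem log_div_sub_half_log {n d : ℕ} (hn : n ≠ 0) (hd : d ∣ n) :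
    Real.log ((n / d : ℕ) : ℝ) - Real.log n / 2 = -(Real.log d - Real.log n / 2) := by
  have hd0 : d ≠ 0 := by
    rintro rfl
    exact hn (zero_dvd_iff.1 hd)
  rw [Nat.cast_div hd (Nat.cast_ne_zero.2 hd0),
    Real.log_div (Nat.cast_ne_zero.2 hn) (Nat.cast_ne_zero.2 hd0)]
  ring

/-- ★ **Liouville parity of the divisor comb.** For `n ≠ 0`, an even profile `φ` and amplitudes
with `a(n/d) = a(d)` on the divisors of `n`, the Liouville-signed comb
`g(x) = Σ_{d ∣ n} (-1)^{Ω(d)} a(d) φ(x - (log d - ½ log n))` satisfies `g(-x) = (-1)^{Ω(n)} g(x)`.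
Proof: reindex the divisor sum by `d ↦ n/d` (`Nat.sum_div_divisors`), reflect the positions
(`log_div_sub_half_log`), use the evenness of `φ` and `(-1)^{Ω(n/d)} = (-1)^{Ω(n)}(-1)^{Ω(d)}`. -/
theorem liouvilleComb_neg {n : ℕ} (hn : n ≠ 0) {φ : ℝ → ℂ} (hφ : ∀ x, φ (-x) = φ x)
    {a : ℕ → ℂ} (ha : ∀ d ∈ n.divisors, a (n / d) = a d) (x : ℝ) :
    (∑ d ∈ n.divisors, (-1 : ℂ) ^ Ω d * a d * φ (-x - (Real.log d - Real.log n / 2))) =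
      (-1) ^ Ω n * ∑ d ∈ n.divisors, (-1 : ℂ) ^ Ω d * a d * φ (x - (Real.log d - Real.log n / 2)) := by
  rw [Finset.mul_sum,
    ← Nat.sum_div_divisors n (fun d ↦ (-1 : ℂ) ^ Ω d * a d * φ (-x - (Real.log d - Real.log n / 2)))]
  refine Finset.sum_congr rfl fun d hd ↦ ?_
  have hdn : d ∣ n := Nat.dvd_of_mem_divisors hd
  rw [log_div_sub_half_log hn hdn, neg_one_pow_cardFactors_div hn hdn, ha d hd]
  have : -x - -(Real.log d - Real.log n / 2) = -(x - (Real.log d - Real.log n / 2)) := by ring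
  rw [this, hφ]
  ring

/-- When `λ(n) = +1` (`Ω(n)` even) the Liouville-signed divisor comb is EVEN — it fits the even
free sector as soon as the cluster of `n` fits the window. -/
theorem liouvilleComb_even {n : ℕ} (hn : n ≠ 0) (hΩ : Even (Ω n)) {φ : ℝ → ℂ} (hφ : ∀ x, φ (-x) = φ x)
    {a : ℕ → ℂ} (ha : ∀ d ∈ n.divisors, a (n / d) = a d) (x : ℝ) :
    (∑ d ∈ n.divisors, (-1 : ℂ) ^ Ω d * a d * φ (-x - (Real.log d - Real.log n / 2))) =
      ∑ d ∈ n.divisors, (-1 : ℂ) ^ Ω d * a d * φ (x - (Real.log d - Real.log n / 2)) := by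
  rw [liouvilleComb_neg hn hφ ha, hΩ.neg_one_pow, one_mul]

/-- When `λ(n) = -1` (`Ω(n)` odd) the Liouville-signed divisor comb is ODD — it fits the odd free
sector first; the even sector needs an extra node (room), hence its plateau. -/
theorem liouvilleComb_odd {n : ℕ} (hn : n ≠ 0) (hΩ : Odd (Ω n)) {φ : ℝ → ℂ} (hφ : ∀ x, φ (-x) = φ x)
    {a : ℕ → ℂ} (ha : ∀ d ∈ n.divisors, a (n / d) = a d) (x : ℝ) :
    (∑ d ∈ n.divisors, (-1 : ℂ) ^ Ω d * a d * φ (-x - (Real.log d - Real.log n / 2))) =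
      -∑ d ∈ n.divisors, (-1 : ℂ) ^ Ω d * a d * φ (x - (Real.log d - Real.log n / 2)) := by
  rw [liouvilleComb_neg hn hφ ha, hΩ.neg_one_pow, neg_one_mul]

end Summit.RiemannHypothesis.RiemannHypothesis.Theorems.SemilocalDeletionLiouvilleParity
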